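import Mathlib

/-!
# PneNP / OverlapGapAlgebra — `SearchHardWindow` / `SolvableImpliesStableSection`:
# SEQUENTIAL LOCAL RULES are ℓ²-stable (2/4, part a) — four generic inequalities

Support for cruxes `stmt-PneNP-2460` and `stmt-PneNP-2463` (the sequential local rung). The
second-moment recursion for increasing cones (file 2/4, part b) uses only the following generic
facts, proved here once in "lens" form (a coordinate of a finite product given by a read map
`ρ : S → X` and a write map `υ : S → X → S` with the three lens laws — the clause `Φ ↦ Φ c`, the
slot `Φ ↦ Φ c j`):

* `shwSeq_lens_fibre_const`, `shwSeq_lens_sum_mul` — FACTORISATION: a weight of the coordinate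
  times a function blind to the coordinate sums to the product of the two averages,
  `#X · ∑_s w(ρ s) G(s) = (∑_x w x) · ∑_s G(s)`;
* `shwSeq_lens_exchange` — EXCHANGE BOUND: if `G` can only grow when the coordinate is rewritten
  away from a value in `P`, then `#X · ∑_{P(ρ s)} G(s) ≤ #P · ∑_s G(s)`;
* `shwSeq_sq_one_add_sum_le` — Cauchy–Schwarz in the form `(1 + ∑ tᵢ)² ≤ (1 + #s)(1 + ∑ tᵢ²)`;
* `shwSeq_gronwall` — discrete Grönwall: `f(v) ≤ A + (B/N) ∑_{v<u<N} f(u)` for all `v < N`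
  forces `f(v) ≤ A (1 + B/N)^{N-1-v} ≤ A e^B`.
No definitions; axioms `propext`, `Classical.choice`, `Quot.sound`.
-/

set_option linter.dupNamespace false -- `Summit.PneNP.PneNP.…`: summit = sub-problem (D-0017)

namespace Summit.PneNP.PneNP.Theorems

open Finset
open scoped Classical

section Lens

variable {S X : Type*} [Fintype S] [Fintype X]

omit [Fintype X] in
/-- Fibres of a lens carry the same `G`-mass when `G` is blind to the coordinate. -/
theorem shwSeq_lens_fibre_const (ρ : S → X) (υ : S → X → S)
    (h1 : ∀ s x, ρ (υ s x) = x) (h2 : ∀ s x x', υ (υ s x) x' = υ s x')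
    (h3 : ∀ s, υ s (ρ s) = s) (G : S → ℝ) (hG : ∀ s x, G (υ s x) = G s) (x x' : X) :
    ∑ s ∈ (univ : Finset S).filter (fun s => ρ s = x), G s =
      ∑ s ∈ (univ : Finset S).filter (fun s => ρ s = x'), G s := by
  refine Finset.sum_nbij' (fun s => υ s x') (fun s => υ s x) ?_ ?_ ?_ ?_ ?_
  · intro s hs
    simp only [mem_filter, mem_univ, true_and] at hs ⊢
    exact h1 s x'
  · intro s hs
    simp only [mem_filter, mem_univ, true_and] at hs ⊢
    exact h1 s x
  · intro s hs
    simp only [mem_filter, mem_univ, true_and] at hs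
    rw [h2, ← hs, h3]
  · intro s hs
    simp only [mem_filter, mem_univ, true_and] at hs
    rw [h2, ← hs, h3]
  · intro s _
    rw [hG]

/-- **Factorisation along a lens.** `#X · ∑_s w(ρ s) G(s) = (∑_x w x) · ∑_s G(s)` whenever `G`
is blind to the coordinate. -/
theorem shwSeq_lens_sum_mul (ρ : S → X) (υ : S → X → S)
    (h1 : ∀ s x, ρ (υ s x) = x) (h2 : ∀ s x x', υ (υ s x) x' = υ s x')
    (h3 : ∀ s, υ s (ρ s) = s) (w : X → ℝ) (G : S → ℝ) (hG : ∀ s x, G (υ s x) = G s) :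
    (Fintype.card X : ℝ) * ∑ s, w (ρ s) * G s = (∑ x, w x) * ∑ s, G s := by
  rcases isEmpty_or_nonempty X with hX | ⟨⟨x₀⟩⟩
  · simp
  set F : X → ℝ := fun x => ∑ s ∈ (univ : Finset S).filter (fun s => ρ s = x), G s with hF
  have hconst : ∀ x, F x = F x₀ := fun x =>
    shwSeq_lens_fibre_const ρ υ h1 h2 h3 G hG x x₀
  have hL : ∑ s, w (ρ s) * G s = (∑ x, w x) * F x₀ := by
    rw [← Finset.sum_fiberwise (univ : Finset S) ρ (fun s => w (ρ s) * G s)]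
    rw [Finset.sum_mul]
    refine Finset.sum_congr rfl fun x _ => ?_
    rw [← hconst x, hF, Finset.mul_sum]
    refine Finset.sum_congr rfl fun s hs => ?_
    simp only [mem_filter, mem_univ, true_and] at hs
    rw [hs]
  have hR : ∑ s, G s = (Fintype.card X : ℝ) * F x₀ := by
    rw [← Finset.sum_fiberwise (univ : Finset S) ρ G]
    rw [Finset.sum_congr rfl fun x _ => hconst x, Finset.sum_const, nsmul_eq_mul, Finset.card_univ]
  rw [hL, hR]; ring

/-- **Exchange bound along a lens.** If rewriting the coordinate away from a value satisfying `P`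
can only increase `G`, then `#X · ∑_{P (ρ s)} G(s) ≤ #{x | P x} · ∑_s G(s)`. -/
theorem shwSeq_lens_exchange (ρ : S → X) (υ : S → X → S)
    (h1 : ∀ s x, ρ (υ s x) = x) (h2 : ∀ s x x', υ (υ s x) x' = υ s x')
    (h3 : ∀ s, υ s (ρ s) = s) (P : X → Prop) (G : S → ℝ)
    (hmono : ∀ s, P (ρ s) → ∀ x, G s ≤ G (υ s x)) :
    (Fintype.card X : ℝ) * ∑ s ∈ (univ : Finset S).filter (fun s => P (ρ s)), G s ≤
      (((univ : Finset X).filter P).card : ℝ) * ∑ s, G s := by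
  -- pointwise: `#X · G s ≤ ∑_x G (υ s x)` on the `P`-fibres
  have hpt : ∀ s ∈ (univ : Finset S).filter (fun s => P (ρ s)),
      (Fintype.card X : ℝ) * G s ≤ ∑ x, G (υ s x) := by
    intro s hs
    simp only [mem_filter, mem_univ, true_and] at hs
    calc (Fintype.card X : ℝ) * G s = ∑ _x : X, G s := by
          rw [Finset.sum_const, nsmul_eq_mul, Finset.card_univ]
      _ ≤ ∑ x, G (υ s x) := Finset.sum_le_sum fun x _ => hmono s hs x
  calc (Fintype.card X : ℝ) * ∑ s ∈ (univ : Finset S).filter (fun s => P (ρ s)), G s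
      = ∑ s ∈ (univ : Finset S).filter (fun s => P (ρ s)), (Fintype.card X : ℝ) * G s := by
        rw [Finset.mul_sum]
    _ ≤ ∑ s ∈ (univ : Finset S).filter (fun s => P (ρ s)), ∑ x, G (υ s x) :=
        Finset.sum_le_sum hpt
    _ = ∑ x, ∑ s ∈ (univ : Finset S).filter (fun s => P (ρ s)), G (υ s x) := Finset.sum_comm
    _ = ∑ x, ∑ x' ∈ (univ : Finset X).filter P,
          ∑ s ∈ (univ : Finset S).filter (fun s => ρ s = x'), G (υ s x) := by
        refine Finset.sum_congr rfl fun x _ => ?_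
        rw [← Finset.sum_fiberwise ((univ : Finset S).filter (fun s => P (ρ s))) ρ
          (fun s => G (υ s x))]
        rw [← Finset.sum_filter_add_sum_filter_not (univ : Finset X) P]
        have hzero : ∑ x' ∈ (univ : Finset X).filter (fun x' => ¬ P x'),
            ∑ s ∈ ((univ : Finset S).filter (fun s => P (ρ s))).filter (fun s => ρ s = x'),
              G (υ s x) = 0 := by
          refine Finset.sum_eq_zero fun x' hx' => ?_
          simp only [mem_filter, mem_univ, true_and] at hx'
          refine Finset.sum_eq_zero fun s hs => ?_
          simp only [mem_filter, mem_univ, true_and] at hs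
          exact absurd (hs.2 ▸ hs.1) hx'
        rw [hzero, add_zero]
        refine Finset.sum_congr rfl fun x' hx' => ?_
        simp only [mem_filter, mem_univ, true_and] at hx'
        refine Finset.sum_congr ?_ fun _ _ => rfl
        ext s
        simp only [mem_filter, mem_univ, true_and]
        constructor
        · rintro ⟨_, h⟩; exact h
        · intro h; exact ⟨h ▸ hx', h⟩
    _ = ∑ x, ∑ x' ∈ (univ : Finset X).filter P,
          ∑ s ∈ (univ : Finset S).filter (fun s => ρ s = x), G s := by
        refine Finset.sum_congr rfl fun x _ => Finset.sum_congr rfl fun x' _ => ?_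
        -- the bijection `s ↦ υ s x` from the `x'`-fibre onto the `x`-fibre
        refine Finset.sum_nbij' (fun s => υ s x) (fun s => υ s x') ?_ ?_ ?_ ?_ ?_
        · intro s hs
          simp only [mem_filter, mem_univ, true_and] at hs ⊢
          exact h1 s x
        · intro s hs
          simp only [mem_filter, mem_univ, true_and] at hs ⊢
          exact h1 s x'
        · intro s hs
          simp only [mem_filter, mem_univ, true_and] at hs
          rw [h2, ← hs, h3]
        · intro s hs
          simp only [mem_filter, mem_univ, true_and] at hs
          rw [h2, ← hs, h3]
        · intro s _; rfl
    _ = (((univ : Finset X).filter P).card : ℝ) * ∑ s, G s := by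
        rw [Finset.sum_comm, Finset.sum_const, nsmul_eq_mul]
        congr 1
        exact Finset.sum_fiberwise (univ : Finset S) ρ G

end Lens

section Elementary

/-- Cauchy–Schwarz with a leading `1`: `(1 + ∑ tᵢ)² ≤ (1 + #s)(1 + ∑ tᵢ²)`. -/
theorem shwSeq_sq_one_add_sum_le {ι : Type*} (s : Finset ι) (t : ι → ℝ) :
    (1 + ∑ i ∈ s, t i) ^ 2 ≤ (1 + s.card) * (1 + ∑ i ∈ s, t i ^ 2) := by
  have hcs : (∑ i ∈ s, t i) ^ 2 ≤ s.card * ∑ i ∈ s, t i ^ 2 := sq_sum_le_card_mul_sum_sq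
  have hlin : 2 * ∑ i ∈ s, t i ≤ s.card + ∑ i ∈ s, t i ^ 2 := by
    have h : ∀ i ∈ s, 2 * t i ≤ 1 + t i ^ 2 := fun i _ => by nlinarith [sq_nonneg (t i - 1)]
    have := Finset.sum_le_sum h
    rw [← Finset.mul_sum, Finset.sum_add_distrib, Finset.sum_const, nsmul_eq_mul, mul_one] at this
    exact this
  have hc : (0 : ℝ) ≤ s.card := Nat.cast_nonneg _
  have hq : (0 : ℝ) ≤ ∑ i ∈ s, t i ^ 2 := Finset.sum_nonneg fun i _ => sq_nonneg _
  nlinarith [hcs, hlin, mul_nonneg hc hq]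

/-- `(1 + B/N)^d ≤ e^B` for `d ≤ N` and `B ≥ 0`. -/
theorem shwSeq_one_add_div_pow_le_exp (B : ℝ) (hB : 0 ≤ B) (N d : ℕ) (hN : 0 < N) (hd : d ≤ N) :
    (1 + B / N) ^ d ≤ Real.exp B := by
  have hNpos : (0 : ℝ) < N := by exact_mod_cast hN
  have h1 : 1 + B / N ≤ Real.exp (B / N) := by
    have := Real.add_one_le_exp (B / N); linarith
  have h0 : (0 : ℝ) ≤ 1 + B / N := by positivity
  calc (1 + B / N) ^ d ≤ Real.exp (B / N) ^ d := pow_le_pow_left₀ h0 h1 d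
    _ = Real.exp (B / N * d) := by rw [← Real.exp_nat_mul]; ring_nf
    _ ≤ Real.exp B := by
        rw [Real.exp_le_exp]
        have hdN : (d : ℝ) ≤ N := by exact_mod_cast hd
        calc B / N * d ≤ B / N * N := mul_le_mul_of_nonneg_left hdN (by positivity)
          _ = B := by field_simp

/-- **Discrete Grönwall (downward).** If `f(v) ≤ A + (B/N) ∑_{v < u < N} f(u)` for every
`v < N` (`B ≥ 0`), then `f(v) ≤ A (1 + B/N)^{N-1-v}` for every `v < N`. -/
theorem shwSeq_gronwall_pow (N : ℕ) (f : ℕ → ℝ) (A B : ℝ) (hB : 0 ≤ B)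
    (hf : ∀ v, v < N → f v ≤ A + B / N * ∑ u ∈ Finset.Ico (v + 1) N, f u) :
    ∀ v, v < N → f v ≤ A * (1 + B / N) ^ (N - 1 - v) := by
  have hNpos' : ∀ v, v < N → (0 : ℝ) < N := fun v hv => by exact_mod_cast (Nat.zero_lt_of_lt hv)
  set r : ℝ := 1 + B / N with hr
  -- strong induction on `d = N - 1 - v`
  suffices H : ∀ d, ∀ v, v < N → N - 1 - v = d → f v ≤ A * r ^ d by
    intro v hv; exact H _ v hv rfl
  intro d
  induction d using Nat.strong_induction_on with
  | _ d ih =>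
    intro v hv hd
    have hNpos := hNpos' v hv
    have hr1 : 0 ≤ r - 1 := by
      rw [hr]; have : 0 ≤ B / N := by positivity
      linarith
    have hr0 : 0 ≤ r := by linarith
    -- bound the tail sum by the geometric sum
    have htail : ∑ u ∈ Finset.Ico (v + 1) N, f u ≤ A * ∑ i ∈ Finset.range d, r ^ i := by
      have h1 : ∑ u ∈ Finset.Ico (v + 1) N, f u ≤ ∑ u ∈ Finset.Ico (v + 1) N, A * r ^ (N - 1 - u) := by
        refine Finset.sum_le_sum fun u hu => ?_
        rw [Finset.mem_Ico] at hu
        exact ih (N - 1 - u) (by omega) u hu.2 rfl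
      have h2 : ∑ u ∈ Finset.Ico (v + 1) N, A * r ^ (N - 1 - u) = A * ∑ i ∈ Finset.range d, r ^ i := by
        rw [← Finset.mul_sum]
        congr 1
        rw [Finset.sum_Ico_eq_sum_range]
        have hdN : N - (v + 1) = d := by omega
        rw [hdN]
        rw [← Finset.sum_range_reflect (fun i => r ^ i) d]
        refine Finset.sum_congr rfl fun j hj => ?_
        rw [Finset.mem_range] at hj
        congr 1; omega
      linarith
    have hgeom : (∑ i ∈ Finset.range d, r ^ i) * (r - 1) = r ^ d - 1 := geom_sum_mul r d
    have hBN : B / N = r - 1 := by rw [hr]; ring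
    calc f v ≤ A + B / N * ∑ u ∈ Finset.Ico (v + 1) N, f u := hf v hv
      _ ≤ A + B / N * (A * ∑ i ∈ Finset.range d, r ^ i) := by
          have : 0 ≤ B / N := by positivity
          nlinarith [htail]
      _ = A * r ^ d := by
          rw [hBN]
          have : (r - 1) * (A * ∑ i ∈ Finset.range d, r ^ i) = A * (r ^ d - 1) := by
            rw [← hgeom]; ring
          rw [this]; ring

/-- **Discrete Grönwall, exponential form.** Under the same hypothesis, `f(v) ≤ A e^B`. -/
theorem shwSeq_gronwall (N : ℕ) (f : ℕ → ℝ) (A B : ℝ) (hA : 0 ≤ A) (hB : 0 ≤ B)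
    (hf : ∀ v, v < N → f v ≤ A + B / N * ∑ u ∈ Finset.Ico (v + 1) N, f u) :
    ∀ v, v < N → f v ≤ A * Real.exp B := by
  intro v hv
  have h := shwSeq_gronwall_pow N f A B hB hf v hv
  have hN : 0 < N := Nat.zero_lt_of_lt hv
  exact h.trans (mul_le_mul_of_nonneg_left
    (shwSeq_one_add_div_pow_le_exp B hB N (N - 1 - v) hN (by omega)) hA)

end Elementary

end Summit.PneNP.PneNP.Theorems
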